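import Summits.Ventures.HSemireg.WedgeHankelRecurrenceGaussChristoffelFunction

/-!
# Venture HSemireg — **THE MARKOV–STIELTJES DISTANCE BOUND**: two positive discrete measures `(ν, w)`, `(ν′, w′)` with THE SAME MOMENTS up to order `2n + 2` have distribution functions that
# differ, at EVERY real point `ξ`, by at most the Christoffel function: `|ν{w ≤ ξ} − ν′{w′ ≤ ξ}| · K_{n+1}(ξ, ξ) ≤ 1` and `|ν{w < ξ} − ν′{w′ < ξ}| · K_{n+1}(ξ, ξ) ≤ 1`
# (`K_{n+1}(ξ, ξ) = Σ_{j ≤ n+1} q_j(ξ)² ∕ h_j`, the common kernel), because both are pinned between the same two consecutive partial sums of the rule through `ξ`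

HONEST FRAMING. Part of the Lean index of the computation cell `pub-hsemireg` (seat p10 gen 43, Sunday typer «UNIFORM-IN-n»).  Real polynomials and finite sums only; no variety, no cohomology
theory, no sheaf, no Ext group and no semiregularity map is constructed here; nothing here says that HC / HC_CM / HC_AV holds; no Literature fact (unproved `Prop`) is declared or used.  Custodian
versions as in `WedgeHankelSiegelIdeal` (1/3).
SOURCES (cited).  P. L. Chebyshev, *Sur les valeurs limites des intégrales*, J. Math. Pures Appl. 19 (1874) 157–160; A. A. Markov, *Démonstration de certaines inégalités de M. Tchébychef*, Math.
Ann. 24 (1884) 172–180; T. J. Stieltjes, *Recherches sur les fractions continues*, Ann. Fac. Sci. Toulouse 8 (1894), §§ 7–8; G. Szegő, *Orthogonal Polynomials*, Thm 3.41.1 and §3.411; G. Freud,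
*Orthogonal Polynomials* (1971), Thm I.5.4 and §II.3 (`|μ_1(−∞, ξ] − μ_2(−∞, ξ]| ≤ λ_n(ξ)` for two solutions of a moment problem); N. I. Akhiezer, *The Classical Moment Problem*, Thm 2.5.3–2.5.4;
M. G. Krein, A. A. Nudel'man, *The Markov Moment Problem*, Ch. III §3.
PROOF TYPED HERE.  If `q_{n+1}(ξ) ≠ 0`, N296 `quasi_gauss_weight_at_eq_christoffel` supplies a positive rule `(λ, y)` through `ξ = y_i`, exact for `ν` in degree `≤ 2n + 2`, with `λ_i K_{n+1}(ξ, ξ) = 1`;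
having the same moments, it is exact for `ν′` too, so N272 `cms_abs_mass_sub_mass_le_weight` (and N271 for the strict sets) bound the differences by `λ_i`.  If `q_{n+1}(ξ) = 0`, the Gauss rule with
`n + 1` nodes does the same with `λ_i K_n(ξ, ξ) = 1` (N277) and `K_{n+1}(ξ, ξ) = K_n(ξ, ξ)`.
DEDUP DISCLOSURE (`rg -n 'markov_stieltjes_dist|abs_mass.*kernel|cms_abs' Summits Literature`, 2026-09-03): N272 `cms_abs_mass_sub_mass_le_weight` is the bound `≤ λ_k` at the nodes of a
given common rule; here the point is arbitrary and the bound is the kernel.  The 4 names below: 0 hits tree-wide.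

WHAT IS IN THE TREE.  N271 `chebyshev_markov_stieltjes`; N272 `cms_abs_mass_sub_mass_le_weight`, `sum_filter_le_eq_sum_filter_lt_add`; N277 `gauss_weight_mul_kernel_diag_eq_one`; N265
`sum_mul_eval_eq_of_orthogonal`, `gauss_weight_pos`; N279 `recurrence_zeros`, `recurrence_monic_natDegree`, `eq_prod_X_sub_C_of_monic_of_roots`; N295 `exists_positive_recurrence_of_orthogonal`;
N296 `quasi_gauss_weight_at_eq_christoffel`, `kernelPoly_eval_self_eq`.
THIS FILE (namespace `Summit.Ventures.HSemireg.Wedge.HankelOuter` continued; CHAINED on N296 (import), N271, N272, N277, N265, N279, N295; 0 definitions):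
* §1062 `abs_sub_le_of_mem_Icc_of_mem_Icc` (two numbers in `[a, a + λ]` differ by `≤ λ`), `cms_abs_mass_lt_sub_mass_lt_le_weight` (the strict-set companion of N272's lemma, any common rule),
  **`exists_rule_through_forall`** (for EVERY real `ξ`: a positive rule through `ξ` exact for `ν` in degree `≤ 2t`, `t ∈ {n, n + 1}`, whose weight at `ξ` satisfies `λ_i · K_{n+1}(ξ, ξ) = 1`),
  **`markov_stieltjes_distance_le`** (THE THEOREM: `|ν{w ≤ ξ} − ν′{w′ ≤ ξ}| · K_{n+1}(ξ, ξ) ≤ 1` and `|ν{w < ξ} − ν′{w′ < ξ}| · K_{n+1}(ξ, ξ) ≤ 1` for all real `ξ`, whenever the moments agree up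
  to order `2n + 2`).
CAVEATS.  Discrete positive measures with finitely many atoms; `ν′ ≥ 0` may have any number of atoms.  Nothing Ext-side.  New names only.
-/

open Module Polynomial
open scoped Matrix Polynomial

namespace Summit.Ventures.HSemireg.Wedge.HankelOuter

/-! ## §1062. The Markov–Stieltjes distance bound -/

/-- Two real numbers confined to the same interval `[a, b]` with `b ≤ a + λ` differ by at most `λ`. [mechanism; this file, §1062] -/
theorem abs_sub_le_of_mem_Icc_of_mem_Icc {a b lam u v : ℝ} (hu : a ≤ u ∧ u ≤ b) (hv : a ≤ v ∧ v ≤ b) (hab : b ≤ a + lam) : |u - v| ≤ lam := by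
  rw [abs_sub_le_iff]
  constructor <;> linarith [hu.1, hu.2, hv.1, hv.2]

/-- **Strict-set companion of N272's lemma**: if a rule `(λ, x)` (`x` strictly increasing) is exact in degree `≤ 2t` for two measures `ν, ν′ ≥ 0`, then `|ν{w < x_k} − ν′{w′ < x_k}| ≤ λ_k`.
[Szegő Thm 3.41.1; this file, §1062] -/
theorem cms_abs_mass_lt_sub_mass_lt_le_weight {t N N' : ℕ} {μ x : Fin (t + 1) → ℝ} {ν w : Fin N → ℝ} {ν' w' : Fin N' → ℝ} (hx : StrictMono x) (hν : ∀ l, 0 ≤ ν l)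
    (hν' : ∀ l, 0 ≤ ν' l) (hmom : ∀ p, p ≤ 2 * t → ∑ j, μ j * x j ^ p = ∑ l, ν l * w l ^ p) (hmom' : ∀ p, p ≤ 2 * t → ∑ j, μ j * x j ^ p = ∑ l, ν' l * w' l ^ p) (k : Fin (t + 1)) :
    |∑ l ∈ Finset.univ.filter (fun l => w l < x k), ν l - ∑ l ∈ Finset.univ.filter (fun l => w' l < x k), ν' l| ≤ μ k := by
  obtain ⟨h1, h2, h3⟩ := chebyshev_markov_stieltjes hx hν hmom k
  obtain ⟨h1', h2', h3'⟩ := chebyshev_markov_stieltjes hx hν' hmom' k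
  rw [sum_filter_le_eq_sum_filter_lt_add μ k] at h3 h3'
  rw [abs_sub_le_iff]
  constructor <;> linarith

/-- **A rule through every real point, with the Christoffel weight.**  Let `ν_l > 0` on `N` distinct nodes, `n + 2 < N`, with orthogonal polynomials `q_0, …, q_{n+2}`.  For EVERY real `ξ` there
is a positive rule `(λ, x)` with `t + 1` nodes `x_0 < ⋯ < x_t` (`t = n` if `q_{n+1}(ξ) = 0`, else `t = n + 1`), `x_i = ξ`, exact for `ν` in degree `≤ 2t`, and
`λ_i · Σ_{j ≤ n+1} q_j(ξ)² ∕ h_j = 1`. [Szegő (3.4.8) + §3.411; Akhiezer Thm 2.5.2; this file, §1062] -/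
theorem exists_rule_through_forall {N n : ℕ} {ν w : Fin N → ℝ} (hν : ∀ l, 0 < ν l) (hw : Function.Injective w) (hnN : n + 2 < N) {q : ℕ → ℝ[X]} (hq0 : q 0 = 1)
    (hmonic : ∀ k, k ≤ n + 2 → (q k).Monic) (hdeg : ∀ k, k ≤ n + 2 → (q k).natDegree = k)
    (horth : ∀ k, k ≤ n + 2 → ∀ G : ℝ[X], G.natDegree < k → ∑ l, ν l * (q k * G).eval (w l) = 0) (ξ : ℝ) :
    ∃ (t : ℕ) (μ x : Fin (t + 1) → ℝ) (i : Fin (t + 1)), n ≤ t ∧ t ≤ n + 1 ∧ StrictMono x ∧ x i = ξ ∧ (∀ j, 0 < μ j) ∧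
      (∀ p, p ≤ 2 * t → ∑ j, μ j * x j ^ p = ∑ l, ν l * w l ^ p) ∧ μ i * ∑ j ∈ Finset.range (n + 2), ((q j).eval ξ) ^ 2 / ∑ l, ν l * ((q j).eval (w l)) ^ 2 = 1 := by
  have hh : ∀ k, k ≤ n + 1 → ∑ l, ν l * ((q k).eval (w l)) ^ 2 ≠ 0 := fun k hk =>
    (sum_mul_eval_sq_pos_of_natDegree_lt hν hw (hmonic k (by omega)).ne_zero (by rw [hdeg k (by omega)]; omega)).ne'
  by_cases hξ : (q (n + 1)).eval ξ = 0
  · -- `ξ` is a zero of `q_{n+1}`: the Gauss rule with `n + 1` nodes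
    obtain ⟨a, b, Q, hQ0, hQ1, hQrec, hb, hagree⟩ := exists_positive_recurrence_of_orthogonal hν hw hnN hq0 hmonic hdeg horth
    obtain ⟨z, hz, hzr, -⟩ := recurrence_zeros hQ0 hQ1 hQrec hb n
    have hmd := recurrence_monic_natDegree hQ0 hQ1 hQrec (n + 1)
    have hprod : q (n + 1) = ∏ k, (Polynomial.X - C (z k)) := by
      rw [← hagree (n + 1) (by omega)]; exact eq_prod_X_sub_C_of_monic_of_roots hmd.1 hmd.2 hz.injective hzr
    have hroot : (∏ k, (Polynomial.X - C (z k))).eval ξ = 0 := by rw [← hprod]; exact hξ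
    rw [eval_prod, Finset.prod_eq_zero_iff] at hroot
    obtain ⟨i, -, hi⟩ := hroot
    rw [eval_sub, eval_X, eval_C, sub_eq_zero] at hi
    have horthz : ∀ G : ℝ[X], G.natDegree ≤ n → ∑ l, ν l * ((∏ j, (Polynomial.X - C (z j))) * G).eval (w l) = 0 := fun G hG => by
      rw [← hprod]; exact horth (n + 1) (by omega) G (by omega)
    set μ : Fin (n + 1) → ℝ := fun k => ∑ l, ν l * (Lagrange.basis Finset.univ z k).eval (w l) with hμ
    have hmom : ∀ p, p ≤ 2 * n + 1 → ∑ k, μ k * z k ^ p = ∑ l, ν l * w l ^ p := fun p hp => by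
      have h := sum_mul_eval_eq_of_orthogonal hz.injective horthz (μ := μ) (fun k => rfl) (F := Polynomial.X ^ p) (by rw [natDegree_X_pow]; exact hp)
      simpa only [eval_pow, eval_X] using h
    have hmom' : ∀ p, p ≤ 2 * n → ∑ k, μ k * z k ^ p = ∑ l, ν l * w l ^ p := fun p hp => hmom p (by omega)
    have hpos : ∀ k, 0 < μ k := gauss_weight_pos hz.injective hν hw (by omega) hmom'
    have hker := gauss_weight_mul_kernel_diag_eq_one (t := n) (fun k hk => hmonic k (by omega)) (fun k hk => hdeg k (by omega)) (fun k hk => horth k (by omega))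
      (fun k hk => hh k (by omega)) hz.injective hmom' i
    rw [← hi] at hker
    refine ⟨n, μ, z, i, le_rfl, by omega, hz, hi.symm, hpos, hmom', ?_⟩
    rw [Finset.sum_range_succ, hξ, zero_pow two_ne_zero, zero_div, add_zero]
    exact hker
  · obtain ⟨y, μ, i, hy, hyi, hpos, hmom, hker, -⟩ := quasi_gauss_weight_at_eq_christoffel hν hw hnN hq0 hmonic hdeg horth hξ
    exact ⟨n + 1, μ, y, i, by omega, le_rfl, hy, hyi, hpos, fun p hp => hmom p (by omega), hker⟩

/-- **THE MARKOV–STIELTJES DISTANCE BOUND.**  Let `ν_l > 0` on `N` distinct nodes `w_l`, `n + 2 < N`, with orthogonal polynomials `q_0, …, q_{n+2}` and `h_j = Σ_l ν_l q_j(w_l)²`; let `ν′ ≥ 0` on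
nodes `w′` have the same moments as `ν` up to order `2n + 2`.  Then for EVERY real `ξ`, with `K = Σ_{j ≤ n+1} q_j(ξ)² ∕ h_j`:
`|ν{w ≤ ξ} − ν′{w′ ≤ ξ}| · K ≤ 1` and `|ν{w < ξ} − ν′{w′ < ξ}| · K ≤ 1`. [Stieltjes 1894 §8; Szegő Thm 3.41.1 ∕ §3.411; Freud Thm I.5.4; Akhiezer Thm 2.5.4; this file, §1062] -/
theorem markov_stieltjes_distance_le {N N' n : ℕ} {ν w : Fin N → ℝ} (hν : ∀ l, 0 < ν l) (hw : Function.Injective w) (hnN : n + 2 < N) {q : ℕ → ℝ[X]} (hq0 : q 0 = 1)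
    (hmonic : ∀ k, k ≤ n + 2 → (q k).Monic) (hdeg : ∀ k, k ≤ n + 2 → (q k).natDegree = k)
    (horth : ∀ k, k ≤ n + 2 → ∀ G : ℝ[X], G.natDegree < k → ∑ l, ν l * (q k * G).eval (w l) = 0) {ν' w' : Fin N' → ℝ} (hν' : ∀ l, 0 ≤ ν' l)
    (hmom' : ∀ p, p ≤ 2 * n + 2 → ∑ l, ν' l * w' l ^ p = ∑ l, ν l * w l ^ p) (ξ : ℝ) :
    |∑ l ∈ Finset.univ.filter (fun l => w l ≤ ξ), ν l - ∑ l ∈ Finset.univ.filter (fun l => w' l ≤ ξ), ν' l| *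
        ∑ j ∈ Finset.range (n + 2), ((q j).eval ξ) ^ 2 / ∑ l, ν l * ((q j).eval (w l)) ^ 2 ≤ 1 ∧
      |∑ l ∈ Finset.univ.filter (fun l => w l < ξ), ν l - ∑ l ∈ Finset.univ.filter (fun l => w' l < ξ), ν' l| *
        ∑ j ∈ Finset.range (n + 2), ((q j).eval ξ) ^ 2 / ∑ l, ν l * ((q j).eval (w l)) ^ 2 ≤ 1 := by
  obtain ⟨t, μ, x, i, -, ht, hx, hxi, hpos, hmom, hker⟩ := exists_rule_through_forall hν hw hnN hq0 hmonic hdeg horth ξ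
  have hν0 : ∀ l, 0 ≤ ν l := fun l => (hν l).le
  have hmomν' : ∀ p, p ≤ 2 * t → ∑ j, μ j * x j ^ p = ∑ l, ν' l * w' l ^ p := fun p hp => by rw [hmom p hp, hmom' p (by omega)]
  have hle := cms_abs_mass_sub_mass_le_weight hx hν0 hν' hmom hmomν' i
  have hlt := cms_abs_mass_lt_sub_mass_lt_le_weight hx hν0 hν' hmom hmomν' i
  rw [hxi] at hle hlt
  have hKpos : 0 < ∑ j ∈ Finset.range (n + 2), ((q j).eval ξ) ^ 2 / ∑ l, ν l * ((q j).eval (w l)) ^ 2 := by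
    rw [← kernelPoly_eval_self_eq]
    exact kernelPoly_eval_self_pos hν hw (by omega) hq0 (fun k hk => hmonic k (by omega)) (fun k hk => hdeg k (by omega)) ξ
  have hμi : μ i = 1 / ∑ j ∈ Finset.range (n + 2), ((q j).eval ξ) ^ 2 / ∑ l, ν l * ((q j).eval (w l)) ^ 2 := by
    rw [eq_div_iff hKpos.ne']; exact hker
  rw [hμi, le_div_iff₀ hKpos] at hle hlt
  exact ⟨hle, hlt⟩

end Summit.Ventures.HSemireg.Wedge.HankelOuter
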